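import Summits.ResolutionOfSingularities.ResolutionOfSingularities.Theorems.RadicialJungCleanModelsSuffice
import Literature.AlgebraicGeometry.Resolution.LogRegularResolutionGeneralHolds
import HarnessLib

/-!
# Crux `CleanModelsSuffice` (stmt-ResolutionOfSingularities-15883, route `RadicialJung`) — PROVED

The tree proved `RadicialJung.CleanModelsSuffice` CONDITIONALLY on Kato 1994 (10.4) in the `LogAtlas`
rendering — `Theorems.RadicialJung.CleanModelsSuffice.CleanModelsSuffice_of_kato
(hK : Kato1994_logRegularScheme_hasResolution.{0})` (the exceptionalisation game reaches an end state on a proper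
birational regular model, `endState_exists`; Kato (10.4) resolves the normalised cover from there,
`stub_gameEndResolves`; `CleanResolves.cleanResolves_of_self`; pAlteration's per-prime frame).  The named fact
is now a THEOREM of the tree: `Kato1994_logRegularScheme_hasResolution_holds`
(`Literature/AlgebraicGeometry/Resolution/LogRegularResolutionGeneralHolds.lean`, 2026-08-27 — the atlas form
`Kato1994_logRegular_hasResolution_general_holds` via linked KKMS regular refinement of the face fans, transported
to the `LogAtlas` rendering by res-type-037's comparison `Kato1994_logRegularScheme_hasResolution_of_general`).
This file discharges the hypothesis and concludes the crux BY NAME, unconditionally.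
-/

noncomputable section

set_option linter.dupNamespace false -- mandated namespace of this single-conjunct summit

open Literature.AlgebraicGeometry.Resolution

namespace Summit.ResolutionOfSingularities.ResolutionOfSingularities.Theorems

/-- **Crux stmt-ResolutionOfSingularities-15883 `RadicialJung.CleanModelsSuffice`, proved**: for every prime
`p`, purely inseparable regular alterations (PIAlt_p) together with pointwise log-clean regular models of
degree-`p` purely inseparable classes (CleanModels_p) imply `ResolutionInChar p`.  The conditional proof
`CleanModelsSuffice_of_kato` with its Kato 1994 (10.4) hypothesis discharged by
`Kato1994_logRegularScheme_hasResolution_holds`. [folklore] -/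
theorem cleanModelsSuffice_proof :
    Summit.ResolutionOfSingularities.ResolutionOfSingularities.Theses.RadicialJung.CleanModelsSuffice :=
  RadicialJung.CleanModelsSuffice.CleanModelsSuffice_of_kato
    Kato1994_logRegularScheme_hasResolution_holds.{0}

end Summit.ResolutionOfSingularities.ResolutionOfSingularities.Theorems

end
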